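import Summits.QuantumFields.YangMills.Theorems.SwapVirialDeficitBlowUpGnomonicFollowerHessian
import Summits.QuantumFields.YangMills.Theorems.SwapVirialDeficitBlowUpGnomonicLetterFloors
import Summits.QuantumFields.YangMills.Theorems.SwapVirialDeficitQuantitativeLaplaceGaussianCeiling
import Summits.QuantumFields.YangMills.Theorems.SwapVirialDeficitQuantitativeLaplaceStrongConvexOfHessian
import Summits.QuantumFields.YangMills.Theorems.SwapVirialDeficitQuantitativeLaplaceFibreMinimiser
import HarnessLib

/-!
# Route `SwapVirialDeficit` (YangMills): THE FOLLOWER LAPLACE CEILING at a near-flat leader point — the followers integrated EXACTLY, as a Gaussian around their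
# minimiser with the `(1 − 1∕(2d))`-sharp Hessian form, never floored mode by mode
# (cell ym-idea-1, skeleton ➎ (S-core)(b) = memo7 §C(b) ∕ memo10 (L3) ∕ LEAD g97 (T1); shared input of `stub_core_tip` (this seat) and `stub_core_end`;
# free-hands support of ⟨stmt-QuantumFields-24197⟩ `SwapVirialDeficit.SwapGluedStiffness`)

Fix a hub `a ≠ 0`, signs `ε` with all followers on the `+` hemisphere, and a LEADER POINT `η : GnoCoord L` (`η.2.2 = 0`) of the principal gnomonic chart.  The follower
restriction `G_η(y) = F̂(η + gnoFolEmb y)` on the Euclidean follower fibre `V_F = GnoFol L` (`d = 3|Fol L|` dimensions) and the FOLLOWER INTEGRAL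
`J_F(η; b) = ∫_{V_F} e^{−b G_η(y)}·piWeight(y) dy` (the inner integral of `hubIntegral` over the followers at fixed leaders) satisfy:

* §1 ★ `gnoDeficit_fol_ge_mu_min` — the GLOBAL FOLLOWER FLOOR `μ·min(1, ‖y‖²) ≤ G_η(y)` for EVERY leader point (✓`gnoFollower_growth` on the unit box,
  w3 g67's ✓`gnoDeficit_floor_followers` off it), `μ = (2304·L⁶·|Fol L|)⁻¹`; `gnoDeficit_fol_zero` (`G_η(0) = F̂(η)`), `gnoDeficit_leaderPoint_le`
  (thin toron: relations `≤ s` ⟹ `F̂(η) ≤ 300L⁴s²`);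
* §2 ★★ `exists_folMinimiser` — if `F̂(η) ≤ μρ²∕4` with `ρ = μ∕(6·2484000L⁴)` (the radius on which the cubes ✓`fol_third_bound` keep half the coercivity) and the
  leader point is near-flat (relations `≤ s`, `s² ≤ μ²∕(304992000000L⁸)`), then `G_η` has a GLOBAL minimiser `y⋆` with `‖y⋆‖² ≤ F̂(η)∕μ`, `‖y⋆‖ ≤ ρ∕2`,
  `DG_η(y⋆) = 0`, quadratic growth `G_η(y⋆) + (μ∕4)‖y − y⋆‖² ≤ G_η(y)` on `B̄(0,ρ)`, the gap `G_η(y⋆) + 3μρ²∕4 ≤ G_η(y)` off `B̄(0,ρ)`, and the Hessian floor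
  `(μ∕2)‖v‖² ≤ ⟪A_F(η + gnoFolEmb y⋆) v, v⟫` (any family `A_F` of ✓`exists_gnoFolHessian`);
* §3 ★★★ `follower_laplace_ceiling` — under the same hypotheses, for every `b > 0`:
  `J_F(η; b) ≤ e^{−b·m}·(2π∕((1 − 1∕(2d))·b))^{d∕2}∕√det A_F(η + gnoFolEmb y⋆) + e^{−b(m + μR₁²∕4)}·∫ piWeight`,
  `m = G_η(y⋆) = min G_η`, `R₁ = 3μ∕(4d·2484000L⁴)` (✓`form_floor_of_third_directional` at the critical point ∘ ✓`setIntegral_exp_neg_mul_le_gaussian_add_tail`;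
  `piWeight ≤ 1`).  The Gaussian factor is SHARP up to `(1 − 1∕(2d))^{−d∕2} ≤ e^{1∕2}`-type constants; the tail is flat and is beaten by `b ≥ poly(L)·log b`
  downstream; `det A_F(η + gnoFolEmb y⋆)` is matched to `det A_F(η)` ∕ to a flat partner by ✓`abs_log_det_gnoFolHessian_sub_le` (`‖gnoFolEmb y⋆‖ ≤ ‖y⋆‖ ≤ √(F̂(η)∕μ)`).

HONEST LABEL: the follower half of the core's fibred Laplace bound at ONE leader point; the leader-side integrals, the hub matching, the core stubs, ⟨24197⟩ ∕ ⟨24194⟩ OPEN;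
own crux ⟨22884⟩ OPEN (blocked-on ⟨19935⟩); the Yang–Mills mass gap is NOT proved; no summit is proved by a line.  THEOREMS ONLY (0 `def`, 0 `sorry`), standard axioms,
no instances.  Width seat ym-line-sfw-p2-w2 g60 (cell ym-idea-1, free hands), `--supports stmt-QuantumFields-24197`.
References: [cite: Luscher1983, §2]; [cite: Breitung1994, Lemma 26, Lemma 39]; [cite: HasenpflugRudolfSprungk2024, §3.1]; [folklore].
-/

set_option autoImplicit false
set_option synthInstance.maxSize 1024

noncomputable section

open MeasureTheory Quaternion Set Metric Module
open scoped Quaternion BigOperators ENNReal InnerProductSpace ContDiff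
open Literature.MathematicalPhysics.QuantumLattice
open Literature.MathematicalPhysics.QuantumFieldTheory hiding SU2

namespace Summit.QuantumFields.YangMills.Theorems.SwapVirialDeficit.BlowUpRing

open Summit.QuantumFields.YangMills.Theorems.FemtoTransferGap
open Summit.QuantumFields.YangMills.Theorems.FemtoTransferGap.TT
open Summit.QuantumFields.YangMills.Theorems.VirialFluxGap.RingDeficit
open Summit.QuantumFields.YangMills.Theorems.SwapVirialDeficit.SwapRing
open Summit.QuantumFields.YangMills.Theorems.SwapVirialDeficit.Gnomonic (normSq3 normSq3_nonneg piWeight piWeight_pos piWeight_le_one continuous_piWeight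
  integrable_piWeight)
open Summit.QuantumFields.YangMills.Theorems.QuantitativeLaplace (form_floor_of_third_directional setIntegral_exp_neg_mul_le_gaussian_add_tail
  hessian_lower_on_closedBall_of_cubes strongConvex_of_hessian_lower quadratic_growth_of_strongConvex)

variable {L : ℕ} [NeZero L]

/-! ## §1 The global follower floor and the leader point -/

/-- `G_η(0) = F̂(η)`: the follower restriction at the origin is the deficit of the leader point. [folklore] -/
theorem gnoDeficit_fol_zero (z : Fin 3 → Bool) (χ : Site 3 L → SU2) (a : ℍ) (ε : GnoSign L) (η : GnoCoord L) :
    gnoDeficit z χ a ε (η + gnoFolEmb (0 : GnoFol L)) = gnoDeficit z χ a ε η := by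
  rw [map_zero, add_zero]

/-- The follower coordinates of `η + gnoFolEmb y` at a leader point (`η.2.2 = 0`) are the blocks of `y`. [folklore] -/
theorem followers_leaderPoint_add (η : GnoCoord L) (hη : η.2.2 = 0) (y : GnoFol L) : (η + gnoFolEmb y).2.2 = gnoFolBlocks y := by
  rw [gnoFolEmb_apply, Prod.snd_add, Prod.snd_add, hη, zero_add]

/-- ★ **THE GLOBAL FOLLOWER FLOOR** (principal sector, follower signs `+`, leader point `η.2.2 = 0`): `μ·min(1, ‖y‖²) ≤ G_η(y)` for EVERY `y : V_F` and EVERY leader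
point — on the unit sup-box by ✓`gnoFollower_growth` (`μΣ|y_f|² ≤ F̂`), off it by w3 g67's ✓`gnoDeficit_floor_followers` (one letter with `|y_f|² ≥ 1` already costs
`F̂ ≥ μ`), `μ = (2304·L⁶·|Fol L|)⁻¹`. [cite: Luscher1983, §2] -/
theorem gnoDeficit_fol_ge_mu_min (a : ℍ) (ε : GnoSign L) (hε : ε.2.2 = fun _ => true) (η : GnoCoord L) (hη : η.2.2 = 0) (y : GnoFol L) :
    (2304 * (L : ℝ) ^ 6 * (Fintype.card (Fol L) : ℝ))⁻¹ * min 1 (‖y‖ ^ 2) ≤ gnoDeficit (fun _ => false) (fun _ => 1) a ε (η + gnoFolEmb y) := by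
  set μ : ℝ := (2304 * (L : ℝ) ^ 6 * (Fintype.card (Fol L) : ℝ))⁻¹ with hμ
  have hμ0 : 0 ≤ μ := by rw [hμ]; positivity
  by_cases hbox : ∀ f, normSq3 (gnoFolBlocks y f) ≤ 1
  · -- on the unit box: growth from zero
    have h := gnoFollower_growth (L := L) (blowUpPoint 1 (gnomonicPoint a ε η)).1 (gnoFolBlocks y) hbox
    rw [← norm_sq_gnoFol] at h
    have e := gnoDeficit_fol_ray_eq_chart (fun _ => false) (fun _ => 1) a ε η hε hη y 1
    rw [one_smul, one_smul] at e
    rw [e]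
    exact le_trans (mul_le_mul_of_nonneg_left (min_le_right _ _) hμ0) h
  · -- off the unit box: one follower letter is large
    simp only [not_forall, not_le] at hbox
    obtain ⟨f, hf⟩ := hbox
    have h := gnoDeficit_floor_followers a ε (η + gnoFolEmb y)
    rw [followers_leaderPoint_add η hη y] at h
    -- the `f`-th summand is at least `1∕2`
    have hq : ∀ i : Fol L, 0 ≤ ((gnoFolBlocks y i 0) ^ 2 + (gnoFolBlocks y i 1) ^ 2 + (gnoFolBlocks y i 2) ^ 2) /
        (1 + ((gnoFolBlocks y i 0) ^ 2 + (gnoFolBlocks y i 1) ^ 2 + (gnoFolBlocks y i 2) ^ 2)) := fun i => by positivity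
    have hqf : (1 / 2 : ℝ) ≤ ((gnoFolBlocks y f 0) ^ 2 + (gnoFolBlocks y f 1) ^ 2 + (gnoFolBlocks y f 2) ^ 2) /
        (1 + ((gnoFolBlocks y f 0) ^ 2 + (gnoFolBlocks y f 1) ^ 2 + (gnoFolBlocks y f 2) ^ 2)) := by
      have hn : normSq3 (gnoFolBlocks y f) = (gnoFolBlocks y f 0) ^ 2 + (gnoFolBlocks y f 1) ^ 2 + (gnoFolBlocks y f 2) ^ 2 := by
        simp [normSq3, Fin.sum_univ_three]
      rw [← hn]
      rw [div_le_div_iff₀ (by norm_num) (by linarith [normSq3_nonneg (gnoFolBlocks y f)])]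
      linarith
    have hsum : (1 / 2 : ℝ) ≤ ∑ i : Fol L, ((gnoFolBlocks y i 0) ^ 2 + (gnoFolBlocks y i 1) ^ 2 + (gnoFolBlocks y i 2) ^ 2) /
        (1 + ((gnoFolBlocks y i 0) ^ 2 + (gnoFolBlocks y i 1) ^ 2 + (gnoFolBlocks y i 2) ^ 2)) :=
      hqf.trans (Finset.single_le_sum (fun i _ => hq i) (Finset.mem_univ f))
    have hL : (0 : ℝ) < L := by exact_mod_cast NeZero.pos L
    have hcard : (0 : ℝ) < (Fintype.card (Fol L) : ℝ) := by
      have : 0 < Fintype.card (Fol L) := Fintype.card_pos_iff.2 ⟨f⟩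
      exact_mod_cast this
    have hpos : (0 : ℝ) < 1152 * (L : ℝ) ^ 6 * (Fintype.card (Fol L) : ℝ) := by positivity
    have hF : μ ≤ gnoDeficit (fun _ => false) (fun _ => 1) a ε (η + gnoFolEmb y) := by
      rw [hμ]
      have e : (2304 * (L : ℝ) ^ 6 * (Fintype.card (Fol L) : ℝ))⁻¹ = (1 / 2) / (1152 * (L : ℝ) ^ 6 * (Fintype.card (Fol L) : ℝ)) := by
        field_simp; ring
      rw [e, div_le_iff₀ hpos]
      calc (1 / 2 : ℝ) ≤ _ := hsum
        _ ≤ _ := h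
        _ = _ := by ring
    exact le_trans (mul_le_of_le_one_right hμ0 (min_le_left _ _)) hF

/-- ★ **THIN TORON AT THE LEADER POINT**: if the leader tuple of `η` has commutators and σ-relations `≤ s` (Frobenius), then `F̂(η) ≤ 300L⁴s²` (principal sector, follower
signs `+`, `η.2.2 = 0`; ✓`chartDeficit_one_le_of_relations`). [cite: Luscher1983, §2] -/
theorem gnoDeficit_leaderPoint_le (a : ℍ) (ε : GnoSign L) (hε : ε.2.2 = fun _ => true) (η : GnoCoord L) (hη : η.2.2 = 0) {s : ℝ} (hs : 0 ≤ s)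
    (hCC : ∀ μ ν : Fin 3, frobNorm ((((blowUpPoint 1 (gnomonicPoint a ε η)).1 (Fin.castSucc μ) * (blowUpPoint 1 (gnomonicPoint a ε η)).1 (Fin.castSucc ν) : SU2) :
        Matrix (Fin 2) (Fin 2) ℂ) - (((blowUpPoint 1 (gnomonicPoint a ε η)).1 (Fin.castSucc ν) * (blowUpPoint 1 (gnomonicPoint a ε η)).1 (Fin.castSucc μ) : SU2) :
        Matrix (Fin 2) (Fin 2) ℂ)) ≤ s)
    (hσ : ∀ μ : Fin 3, frobNorm ((((blowUpPoint 1 (gnomonicPoint a ε η)).1 (Fin.last 3) *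
        (blowUpPoint 1 (gnomonicPoint a ε η)).1 (Fin.castSucc (Equiv.swap (0 : Fin 3) 1 μ)) : SU2) : Matrix (Fin 2) (Fin 2) ℂ) -
        (((blowUpPoint 1 (gnomonicPoint a ε η)).1 (Fin.castSucc μ) * (blowUpPoint 1 (gnomonicPoint a ε η)).1 (Fin.last 3) : SU2) : Matrix (Fin 2) (Fin 2) ℂ)) ≤ s) :
    gnoDeficit (fun _ => false) (fun _ => 1) a ε η ≤ 300 * (L : ℝ) ^ 4 * s ^ 2 := by
  have e := gnoDeficit_fol_ray_eq_chart (fun _ => false) (fun _ => 1) a ε η hε hη (0 : GnoFol L) 0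
  rw [zero_smul, add_zero] at e
  rw [e]
  have e1 : (fun f : Fol L => quatToSU2 (gnoLetter true (((0 : ℝ) • gnoFolBlocks (0 : GnoFol L)) f))) = fun _ => 1 := by
    funext f; rw [zero_smul]; exact gnoPlus_zero
  rw [e1]
  exact chartDeficit_one_le_of_relations _ hs hCC hσ

/-! ## §2 The follower minimiser -/

/-- `1 ≤ |Fol L|` (`|Fol L| = 6L⁴ − 3`). [folklore] -/
theorem one_le_card_fol : 1 ≤ Fintype.card (Fol L) := by
  have hL1 : 1 ≤ L := Nat.one_le_iff_ne_zero.2 (NeZero.ne L)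
  have h6 : 6 ≤ 6 * L ^ 4 := by nlinarith [Nat.one_le_pow 4 L hL1]
  rw [card_fol]; omega

/-- The follower coercivity constant is positive and at most `1∕2304`. [folklore] -/
theorem folMu_pos_le : 0 < (2304 * (L : ℝ) ^ 6 * (Fintype.card (Fol L) : ℝ))⁻¹ ∧ (2304 * (L : ℝ) ^ 6 * (Fintype.card (Fol L) : ℝ))⁻¹ ≤ 1 / 2304 := by
  have hL : (1 : ℝ) ≤ (L : ℝ) := by exact_mod_cast Nat.one_le_iff_ne_zero.2 (NeZero.ne L)
  have hL6 : (1 : ℝ) ≤ (L : ℝ) ^ 6 := one_le_pow₀ hL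
  have hcard : (1 : ℝ) ≤ (Fintype.card (Fol L) : ℝ) := by exact_mod_cast one_le_card_fol (L := L)
  refine ⟨by positivity, ?_⟩
  rw [one_div]
  exact inv_anti₀ (by norm_num) (by nlinarith)

/-- ★★ **THE FOLLOWER MINIMISER AT A NEAR-FLAT LEADER POINT.**  Principal sector, hub `a ≠ 0`, follower signs `+`, leader point `η.2.2 = 0` with relations `≤ s`,
`s² ≤ μ²∕(304992000000L⁸)` (coercivity ✓`gnoFolHessian_coercive`) and `F̂(η) ≤ μρ²∕4`, `ρ = μ∕(6·2484000L⁴)`.  Then for any follower-Hessian family `A_F` with the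
form and ray identities there is `y⋆ : V_F` with: `‖y⋆‖² ≤ F̂(η)∕μ`, `‖y⋆‖ ≤ ρ∕2`, `G_η(y⋆) ≤ G_η(y)` for ALL `y` (global minimum), `DG_η(y⋆) = 0`, the quadratic growth
`G_η(y⋆) + (μ∕4)‖y − y⋆‖² ≤ G_η(y)` on `B̄(0,ρ)`, the gap `G_η(y⋆) + 3μρ²∕4 ≤ G_η(y)` off `B̄(0,ρ)`, and the Hessian floor `(μ∕2)‖v‖² ≤ ⟪A_F(η + gnoFolEmb y⋆) v, v⟫`.
[cite: Luscher1983, §2] [cite: HasenpflugRudolfSprungk2024, §3.1] -/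
theorem exists_folMinimiser {a : ℍ} (ha : a ≠ 0) (ε : GnoSign L) (hε : ε.2.2 = fun _ => true) (η : GnoCoord L) (hη : η.2.2 = 0)
    {A : GnoCoord L → GnoFol L →ₗ[ℝ] GnoFol L}
    (hAyy : ∀ η' (y : GnoFol L), ⟪A η' y, y⟫_ℝ = iteratedFDeriv ℝ 2 (fun y' : GnoFol L => gnoDeficit (fun _ => false) (fun _ => 1) a ε (η' + gnoFolEmb y')) 0 (fun _ => y))
    (hray : ∀ η' (y : GnoFol L), ⟪A η' y, y⟫_ℝ = iteratedDeriv 2 (fun s : ℝ => gnoDeficit (fun _ => false) (fun _ => 1) a ε (η' + s • gnoFolEmb y)) 0)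
    {s : ℝ} (hs : 0 ≤ s)
    (hCC : ∀ μ ν : Fin 3, frobNorm ((((blowUpPoint 1 (gnomonicPoint a ε η)).1 (Fin.castSucc μ) * (blowUpPoint 1 (gnomonicPoint a ε η)).1 (Fin.castSucc ν) : SU2) :
        Matrix (Fin 2) (Fin 2) ℂ) - (((blowUpPoint 1 (gnomonicPoint a ε η)).1 (Fin.castSucc ν) * (blowUpPoint 1 (gnomonicPoint a ε η)).1 (Fin.castSucc μ) : SU2) :
        Matrix (Fin 2) (Fin 2) ℂ)) ≤ s)
    (hσ : ∀ μ : Fin 3, frobNorm ((((blowUpPoint 1 (gnomonicPoint a ε η)).1 (Fin.last 3) *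
        (blowUpPoint 1 (gnomonicPoint a ε η)).1 (Fin.castSucc (Equiv.swap (0 : Fin 3) 1 μ)) : SU2) : Matrix (Fin 2) (Fin 2) ℂ) -
        (((blowUpPoint 1 (gnomonicPoint a ε η)).1 (Fin.castSucc μ) * (blowUpPoint 1 (gnomonicPoint a ε η)).1 (Fin.last 3) : SU2) : Matrix (Fin 2) (Fin 2) ℂ)) ≤ s)
    (hs2 : s ^ 2 ≤ ((2304 * (L : ℝ) ^ 6 * (Fintype.card (Fol L) : ℝ))⁻¹) ^ 2 / (304992000000 * (L : ℝ) ^ 8))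
    (hflat : gnoDeficit (fun _ => false) (fun _ => 1) a ε η ≤
      (2304 * (L : ℝ) ^ 6 * (Fintype.card (Fol L) : ℝ))⁻¹ * ((2304 * (L : ℝ) ^ 6 * (Fintype.card (Fol L) : ℝ))⁻¹ / (6 * (2484000 * (L : ℝ) ^ 4))) ^ 2 / 4) :
    ∃ ys : GnoFol L,
      ‖ys‖ ^ 2 ≤ gnoDeficit (fun _ => false) (fun _ => 1) a ε η / (2304 * (L : ℝ) ^ 6 * (Fintype.card (Fol L) : ℝ))⁻¹ ∧
      ‖ys‖ ≤ (2304 * (L : ℝ) ^ 6 * (Fintype.card (Fol L) : ℝ))⁻¹ / (6 * (2484000 * (L : ℝ) ^ 4)) / 2 ∧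
      (∀ y : GnoFol L, gnoDeficit (fun _ => false) (fun _ => 1) a ε (η + gnoFolEmb ys) ≤ gnoDeficit (fun _ => false) (fun _ => 1) a ε (η + gnoFolEmb y)) ∧
      fderiv ℝ (fun y' : GnoFol L => gnoDeficit (fun _ => false) (fun _ => 1) a ε (η + gnoFolEmb y')) ys = 0 ∧
      (∀ y ∈ closedBall (0 : GnoFol L) ((2304 * (L : ℝ) ^ 6 * (Fintype.card (Fol L) : ℝ))⁻¹ / (6 * (2484000 * (L : ℝ) ^ 4))),
        gnoDeficit (fun _ => false) (fun _ => 1) a ε (η + gnoFolEmb ys) + (2304 * (L : ℝ) ^ 6 * (Fintype.card (Fol L) : ℝ))⁻¹ / 4 * ‖y - ys‖ ^ 2 ≤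
          gnoDeficit (fun _ => false) (fun _ => 1) a ε (η + gnoFolEmb y)) ∧
      (∀ y : GnoFol L, y ∉ closedBall (0 : GnoFol L) ((2304 * (L : ℝ) ^ 6 * (Fintype.card (Fol L) : ℝ))⁻¹ / (6 * (2484000 * (L : ℝ) ^ 4))) →
        gnoDeficit (fun _ => false) (fun _ => 1) a ε (η + gnoFolEmb ys) +
            3 * (2304 * (L : ℝ) ^ 6 * (Fintype.card (Fol L) : ℝ))⁻¹ * ((2304 * (L : ℝ) ^ 6 * (Fintype.card (Fol L) : ℝ))⁻¹ / (6 * (2484000 * (L : ℝ) ^ 4))) ^ 2 / 4 ≤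
          gnoDeficit (fun _ => false) (fun _ => 1) a ε (η + gnoFolEmb y)) ∧
      (∀ v : GnoFol L, (2304 * (L : ℝ) ^ 6 * (Fintype.card (Fol L) : ℝ))⁻¹ / 2 * ‖v‖ ^ 2 ≤ ⟪A (η + gnoFolEmb ys) v, v⟫_ℝ) := by
  set μ : ℝ := (2304 * (L : ℝ) ^ 6 * (Fintype.card (Fol L) : ℝ))⁻¹ with hμ
  set A₃ : ℝ := 2484000 * (L : ℝ) ^ 4 with hA₃
  set ρ : ℝ := μ / (6 * A₃) with hρ
  set G : GnoFol L → ℝ := fun y' => gnoDeficit (fun _ => false) (fun _ => 1) a ε (η + gnoFolEmb y') with hG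
  obtain ⟨hμpos, hμle⟩ := folMu_pos_le (L := L)
  have hL : (1 : ℝ) ≤ (L : ℝ) := by exact_mod_cast Nat.one_le_iff_ne_zero.2 (NeZero.ne L)
  have hL4 : (1 : ℝ) ≤ (L : ℝ) ^ 4 := one_le_pow₀ hL
  have hA₃pos : 0 < A₃ := by rw [hA₃]; positivity
  have hρpos : 0 < ρ := by rw [hρ]; positivity
  have hρle : ρ ≤ 1 := by
    rw [hρ, div_le_one (by positivity)]
    nlinarith
  -- regularity and cubes
  have hG3 : ContDiff ℝ 3 G := contDiff_gnoDeficit_fol (n := 3) _ _ ha ε η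
  have hG2 : ContDiff ℝ 2 G := hG3.of_le (by norm_num)
  have hcube : ∀ z ∈ closedBall (0 : GnoFol L) ρ, ∀ w : GnoFol L, |iteratedFDeriv ℝ 3 G z (fun _ => w)| ≤ A₃ * ‖w‖ ^ 3 :=
    fun z _ w => fol_third_bound _ _ ha ε η z w
  -- Hessian floor `μ` at the origin, `μ∕2` on the ball
  have hfloor0 : ∀ v : GnoFol L, μ * ‖v‖ ^ 2 ≤ iteratedFDeriv ℝ 2 G 0 (fun _ => v) := fun v => by
    rw [← hAyy]; exact gnoFolHessian_coercive ha ε hε η hη hray hs hCC hσ hs2 v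
  have hfloorBall : ∀ x ∈ closedBall (0 : GnoFol L) ρ, ∀ v : GnoFol L, (μ - 3 * A₃ * ρ) * ‖v‖ ^ 2 ≤ iteratedFDeriv ℝ 2 G x (fun _ => v) :=
    hessian_lower_on_closedBall_of_cubes hG3 hA₃pos.le hcube hfloor0
  have h3 : μ - 3 * A₃ * ρ = μ / 2 := by rw [hρ]; field_simp; ring
  rw [h3] at hfloorBall
  have hsc := strongConvex_of_hessian_lower hG2 hfloorBall
  -- the minimiser on the compact ball
  have hK : IsCompact (closedBall (0 : GnoFol L) ρ) := isCompact_closedBall 0 ρ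
  obtain ⟨ys, hys, hmin⟩ := hK.exists_isMinOn ⟨0, mem_closedBall_self hρpos.le⟩ hG3.continuous.continuousOn
  -- it is small: `μ‖y⋆‖² ≤ G y⋆ ≤ G 0 = F̂(η) ≤ μρ²∕4`
  have hG0 : G 0 = gnoDeficit (fun _ => false) (fun _ => 1) a ε η := gnoDeficit_fol_zero _ _ a ε η
  have hysle0 : G ys ≤ G 0 := hmin (mem_closedBall_self hρpos.le)
  have hys_norm : ‖ys‖ ≤ ρ := mem_closedBall_zero_iff.1 hys
  have hys1 : ‖ys‖ ^ 2 ≤ 1 := by nlinarith [norm_nonneg ys]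
  have hgrow := gnoDeficit_fol_ge_mu_min a ε hε η hη ys
  rw [min_eq_right hys1] at hgrow
  have hys_sq : ‖ys‖ ^ 2 ≤ gnoDeficit (fun _ => false) (fun _ => 1) a ε η / μ := by
    rw [le_div_iff₀ hμpos]
    calc ‖ys‖ ^ 2 * μ = μ * ‖ys‖ ^ 2 := mul_comm _ _
      _ ≤ G ys := hgrow
      _ ≤ _ := hysle0.trans (le_of_eq hG0)
  have hys_half : ‖ys‖ ≤ ρ / 2 := by
    have h1 : ‖ys‖ ^ 2 ≤ ρ ^ 2 / 4 := by
      refine hys_sq.trans ?_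
      rw [div_le_iff₀ hμpos]
      calc gnoDeficit (fun _ => false) (fun _ => 1) a ε η ≤ μ * ρ ^ 2 / 4 := hflat
        _ = ρ ^ 2 / 4 * μ := by ring
    nlinarith [norm_nonneg ys, hρpos]
  -- interior ⟹ critical
  have hys_in : ys ∈ ball (0 : GnoFol L) ρ := by
    rw [mem_ball_zero_iff]; linarith
  have hloc : IsLocalMin G ys := hmin.isLocalMin (closedBall_mem_nhds_of_mem hys_in)
  have hcrit : fderiv ℝ G ys = 0 := hloc.fderiv_eq_zero
  -- quadratic growth on the ball and the gap off it
  have hquad : ∀ y ∈ closedBall (0 : GnoFol L) ρ, G ys + μ / 4 * ‖y - ys‖ ^ 2 ≤ G y := fun y hy => by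
    have h := quadratic_growth_of_strongConvex hsc hys hcrit hy
    have e : μ / 2 / 2 = μ / 4 := by ring
    rw [e] at h; exact h
  have hgap : ∀ y : GnoFol L, y ∉ closedBall (0 : GnoFol L) ρ → G ys + 3 * μ * ρ ^ 2 / 4 ≤ G y := fun y hy => by
    rw [mem_closedBall_zero_iff, not_le] at hy
    have hg := gnoDeficit_fol_ge_mu_min a ε hε η hη y
    have hmin1 : ρ ^ 2 ≤ min 1 (‖y‖ ^ 2) := le_min (by nlinarith) (by nlinarith [norm_nonneg y, hρpos])
    have h1 : μ * ρ ^ 2 ≤ G y := le_trans (mul_le_mul_of_nonneg_left hmin1 hμpos.le) hg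
    have h2 : G ys ≤ μ * ρ ^ 2 / 4 := hysle0.trans (hG0.le.trans hflat)
    linarith
  -- the global minimum
  have hglob : ∀ y : GnoFol L, G ys ≤ G y := fun y => by
    by_cases hy : y ∈ closedBall (0 : GnoFol L) ρ
    · exact hmin hy
    · have := hgap y hy; nlinarith [sq_nonneg ρ, hμpos]
  -- the Hessian floor at the minimiser, on the operator
  have hAys : ∀ v : GnoFol L, μ / 2 * ‖v‖ ^ 2 ≤ ⟪A (η + gnoFolEmb ys) v, v⟫_ℝ := fun v => by
    rw [← gnoFolHessian_translate _ _ ha ε hray η ys v]; exact hfloorBall ys hys v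
  exact ⟨ys, hys_sq, hys_half, hglob, hcrit, hquad, hgap, hAys⟩

/-! ## §3 The ceiling -/

/-- `1 ≤ |Fol|`-type bookkeeping: `9 ≤ d = finrank V_F`. [folklore] -/
theorem nine_le_finrank_gnoFol : (9 : ℝ) ≤ (finrank ℝ (GnoFol L) : ℝ) := by
  rw [finrank_gnoFol_real]
  have hL1 : 1 ≤ L := Nat.one_le_iff_ne_zero.2 (NeZero.ne L)
  have h : 3 ≤ Fintype.card (Fol L) := by
    have h6 : 6 ≤ 6 * L ^ 4 := by nlinarith [Nat.one_le_pow 4 L hL1]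
    rw [card_fol]; omega
  have h' : (3 : ℝ) ≤ (Fintype.card (Fol L) : ℝ) := by exact_mod_cast h
  linarith

/-- The follower weight `y ↦ piWeight (gnoFolBlocks y)` is measurable, positive, `≤ 1` and integrable on `V_F`. [folklore] -/
theorem folWeight_facts :
    Measurable (fun y : GnoFol L => piWeight (gnoFolBlocks y)) ∧ (∀ y : GnoFol L, 0 < piWeight (gnoFolBlocks y)) ∧
      (∀ y : GnoFol L, piWeight (gnoFolBlocks y) ≤ 1) ∧ Integrable (fun y : GnoFol L => piWeight (gnoFolBlocks y)) := by
  have hm : Measurable (fun y : GnoFol L => piWeight (gnoFolBlocks y)) :=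
    continuous_piWeight.measurable.comp (gnoFolBlocksEquiv (L := L)).measurable
  refine ⟨hm, fun y => piWeight_pos _, fun y => piWeight_le_one _, ?_⟩
  have h := (volume_preserving_gnoFolBlocksEquiv (L := L)).integrable_comp_emb (gnoFolBlocksEquiv (L := L)).measurableEmbedding (g := piWeight)
  exact h.2 integrable_piWeight

/-- ★★★ **THE FOLLOWER LAPLACE CEILING AT A NEAR-FLAT LEADER POINT.**  Principal sector, hub `a ≠ 0`, follower signs `+`, leader point `η.2.2 = 0` with relations `≤ s`,
`s² ≤ μ²∕(304992000000L⁸)`, `F̂(η) ≤ μρ²∕4` (`ρ = μ∕(6·2484000L⁴)`, `μ = (2304L⁶|Fol L|)⁻¹`); `A_F` any family of ✓`exists_gnoFolHessian` (symmetric, form + ray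
identities).  Then there is a global follower minimiser `y⋆` (`‖y⋆‖² ≤ F̂(η)∕μ`, Hessian floor `μ∕2` at `η + gnoFolEmb y⋆`) such that for every `b > 0`, with
`m = G_η(y⋆)`, `d = finrank V_F = 3|Fol L|`, `R₁ = 3(μ∕2)∕(2d·2484000L⁴)`:
`∫ e^{−bG_η} piWeight ≤ e^{−bm}·(2π∕((1 − 1∕(2d))b))^{d∕2}∕√det A_F(η + gnoFolEmb y⋆) + e^{−b(m + μR₁²∕4)}·∫ piWeight`.
The followers are integrated EXACTLY: no per-mode loss, the sharp determinant, a flat tail. [cite: Breitung1994, Lemma 39] [cite: Luscher1983, §2] -/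
theorem follower_laplace_ceiling {a : ℍ} (ha : a ≠ 0) (ε : GnoSign L) (hε : ε.2.2 = fun _ => true) (η : GnoCoord L) (hη : η.2.2 = 0)
    {A : GnoCoord L → GnoFol L →ₗ[ℝ] GnoFol L} (hAs : ∀ η', (A η').IsSymmetric)
    (hAyy : ∀ η' (y : GnoFol L), ⟪A η' y, y⟫_ℝ = iteratedFDeriv ℝ 2 (fun y' : GnoFol L => gnoDeficit (fun _ => false) (fun _ => 1) a ε (η' + gnoFolEmb y')) 0 (fun _ => y))
    (hray : ∀ η' (y : GnoFol L), ⟪A η' y, y⟫_ℝ = iteratedDeriv 2 (fun s : ℝ => gnoDeficit (fun _ => false) (fun _ => 1) a ε (η' + s • gnoFolEmb y)) 0)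
    {s : ℝ} (hs : 0 ≤ s)
    (hCC : ∀ μ ν : Fin 3, frobNorm ((((blowUpPoint 1 (gnomonicPoint a ε η)).1 (Fin.castSucc μ) * (blowUpPoint 1 (gnomonicPoint a ε η)).1 (Fin.castSucc ν) : SU2) :
        Matrix (Fin 2) (Fin 2) ℂ) - (((blowUpPoint 1 (gnomonicPoint a ε η)).1 (Fin.castSucc ν) * (blowUpPoint 1 (gnomonicPoint a ε η)).1 (Fin.castSucc μ) : SU2) :
        Matrix (Fin 2) (Fin 2) ℂ)) ≤ s)
    (hσ : ∀ μ : Fin 3, frobNorm ((((blowUpPoint 1 (gnomonicPoint a ε η)).1 (Fin.last 3) *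
        (blowUpPoint 1 (gnomonicPoint a ε η)).1 (Fin.castSucc (Equiv.swap (0 : Fin 3) 1 μ)) : SU2) : Matrix (Fin 2) (Fin 2) ℂ) -
        (((blowUpPoint 1 (gnomonicPoint a ε η)).1 (Fin.castSucc μ) * (blowUpPoint 1 (gnomonicPoint a ε η)).1 (Fin.last 3) : SU2) : Matrix (Fin 2) (Fin 2) ℂ)) ≤ s)
    (hs2 : s ^ 2 ≤ ((2304 * (L : ℝ) ^ 6 * (Fintype.card (Fol L) : ℝ))⁻¹) ^ 2 / (304992000000 * (L : ℝ) ^ 8))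
    (hflat : gnoDeficit (fun _ => false) (fun _ => 1) a ε η ≤
      (2304 * (L : ℝ) ^ 6 * (Fintype.card (Fol L) : ℝ))⁻¹ * ((2304 * (L : ℝ) ^ 6 * (Fintype.card (Fol L) : ℝ))⁻¹ / (6 * (2484000 * (L : ℝ) ^ 4))) ^ 2 / 4) :
    ∃ ys : GnoFol L,
      ‖ys‖ ^ 2 ≤ gnoDeficit (fun _ => false) (fun _ => 1) a ε η / (2304 * (L : ℝ) ^ 6 * (Fintype.card (Fol L) : ℝ))⁻¹ ∧
      (∀ y : GnoFol L, gnoDeficit (fun _ => false) (fun _ => 1) a ε (η + gnoFolEmb ys) ≤ gnoDeficit (fun _ => false) (fun _ => 1) a ε (η + gnoFolEmb y)) ∧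
      (∀ v : GnoFol L, (2304 * (L : ℝ) ^ 6 * (Fintype.card (Fol L) : ℝ))⁻¹ / 2 * ‖v‖ ^ 2 ≤ ⟪A (η + gnoFolEmb ys) v, v⟫_ℝ) ∧
      ∀ b : ℝ, 0 < b →
        ∫ y : GnoFol L, Real.exp (-(b * gnoDeficit (fun _ => false) (fun _ => 1) a ε (η + gnoFolEmb y))) * piWeight (gnoFolBlocks y) ≤
          Real.exp (-(b * gnoDeficit (fun _ => false) (fun _ => 1) a ε (η + gnoFolEmb ys))) *
              ((2 * Real.pi / ((1 - 1 / (2 * (finrank ℝ (GnoFol L) : ℝ))) * b)) ^ ((finrank ℝ (GnoFol L) : ℝ) / 2) /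
                Real.sqrt (LinearMap.det (A (η + gnoFolEmb ys)))) +
            Real.exp (-(b * (gnoDeficit (fun _ => false) (fun _ => 1) a ε (η + gnoFolEmb ys) +
                (2304 * (L : ℝ) ^ 6 * (Fintype.card (Fol L) : ℝ))⁻¹ *
                  (3 * ((2304 * (L : ℝ) ^ 6 * (Fintype.card (Fol L) : ℝ))⁻¹ / 2) / (2 * (finrank ℝ (GnoFol L) : ℝ) * (2484000 * (L : ℝ) ^ 4))) ^ 2 / 4))) *
              ∫ y : GnoFol L, piWeight (gnoFolBlocks y) := by
  obtain ⟨ys, hys_sq, hys_half, hglob, hcrit, hquad, hgap, hAys⟩ := exists_folMinimiser ha ε hε η hη hAyy hray hs hCC hσ hs2 hflat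
  refine ⟨ys, hys_sq, hglob, hAys, fun b hb => ?_⟩
  -- opaque scalars: `μ`, `d`, then `A₃`, `ρ`, `R₁`
  obtain ⟨hμpos, -⟩ := folMu_pos_le (L := L)
  have hd9 := nine_le_finrank_gnoFol (L := L)
  generalize hμdef : (2304 * (L : ℝ) ^ 6 * (Fintype.card (Fol L) : ℝ))⁻¹ = μ at hμpos hys_half hquad hgap hAys hflat ⊢
  generalize hddef : (finrank ℝ (GnoFol L) : ℝ) = d at hd9 ⊢
  have hL : (1 : ℝ) ≤ (L : ℝ) := by exact_mod_cast Nat.one_le_iff_ne_zero.2 (NeZero.ne L)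
  have hL4 : (1 : ℝ) ≤ (L : ℝ) ^ 4 := one_le_pow₀ hL
  set A₃ : ℝ := 2484000 * (L : ℝ) ^ 4 with hA₃
  have hA₃pos : 0 < A₃ := by rw [hA₃]; positivity
  obtain ⟨ρ, hρ⟩ : ∃ ρ : ℝ, ρ = μ / (6 * A₃) := ⟨_, rfl⟩
  rw [← hρ] at hys_half hquad hgap hflat
  have hρpos : 0 < ρ := by rw [hρ]; positivity
  have hdpos : 0 < d := by linarith
  obtain ⟨R₁, hR₁⟩ : ∃ R₁ : ℝ, R₁ = 3 * (μ / 2) / (2 * d * A₃) := ⟨_, rfl⟩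
  rw [← hR₁]
  have hR₁pos : 0 < R₁ := by rw [hR₁]; positivity
  have hμne : μ ≠ 0 := hμpos.ne'
  -- `R₁ ≤ ρ∕2`
  have hR₁le : R₁ ≤ ρ / 2 := by
    rw [hR₁, hρ, div_le_iff₀ (by positivity)]
    rw [show μ / (6 * A₃) / 2 * (2 * d * A₃) = μ * d / 6 by field_simp]; nlinarith
  obtain ⟨hwm, hw0, hw1, hwi⟩ := folWeight_facts (L := L)
  have hG3 : ContDiff ℝ 3 (fun y' : GnoFol L => gnoDeficit (fun _ => false) (fun _ => 1) a ε (η + gnoFolEmb y')) :=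
    contDiff_gnoDeficit_fol (n := 3) _ _ ha ε η
  have hGm : Measurable (fun y' : GnoFol L => gnoDeficit (fun _ => false) (fun _ => 1) a ε (η + gnoFolEmb y')) := hG3.continuous.measurable
  -- the form floor at the critical point on `B̄(y⋆, R₁)` (cubes everywhere, gauge = norm)
  have hcubeN : ∀ z ∈ (univ : Set (GnoFol L)), ∀ u : GnoFol L,
      |iteratedFDeriv ℝ 3 (fun y' : GnoFol L => gnoDeficit (fun _ => false) (fun _ => 1) a ε (η + gnoFolEmb y')) z (fun _ => u)| ≤ A₃ * ‖u‖ * ‖u‖ ^ 2 :=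
    fun z _ u => by
    have h := fol_third_bound (fun _ => false) (fun _ => 1) ha ε η z u
    calc _ ≤ A₃ * ‖u‖ ^ 3 := h
      _ = A₃ * ‖u‖ * ‖u‖ ^ 2 := by ring
  have hlamys : ∀ u : GnoFol L, μ / 2 * ‖u‖ ^ 2 ≤
      iteratedFDeriv ℝ 2 (fun y' : GnoFol L => gnoDeficit (fun _ => false) (fun _ => 1) a ε (η + gnoFolEmb y')) ys (fun _ => u) := fun u => by
    rw [gnoFolHessian_translate (fun _ => false) (fun _ => 1) ha ε hray η ys u]; exact hAys u
  have hδ : 1 - A₃ * R₁ / (3 * (μ / 2)) = 1 - 1 / (2 * d) := by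
    rw [hR₁]; field_simp
  have hfloor : ∀ y ∈ (univ : Set (GnoFol L)) ∩ closedBall ys R₁,
      gnoDeficit (fun _ => false) (fun _ => 1) a ε (η + gnoFolEmb ys) + (1 / 2) * (1 - 1 / (2 * d)) * ⟪A (η + gnoFolEmb ys) (y - ys), y - ys⟫_ℝ ≤
        gnoDeficit (fun _ => false) (fun _ => 1) a ε (η + gnoFolEmb y) := fun y hy => by
    have hbox : ‖y - ys‖ ≤ R₁ := by
      have := hy.2; rwa [mem_closedBall, dist_eq_norm] at this
    have h := form_floor_of_third_directional hG3 convex_univ hA₃pos.le hcubeN (mem_univ ys) (mem_univ y) hcrit (by positivity : 0 < μ / 2) hlamys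
      hR₁pos.le hbox
    have e2 := gnoFolHessian_translate (fun _ => false) (fun _ => 1) ha ε hray η ys (y - ys)
    rw [hδ, e2] at h
    exact h
  -- the far floor off `B̄(y⋆, R₁)`
  have hfar : ∀ y ∈ (univ : Set (GnoFol L)) \ closedBall ys R₁,
      gnoDeficit (fun _ => false) (fun _ => 1) a ε (η + gnoFolEmb ys) + μ * R₁ ^ 2 / 4 ≤ gnoDeficit (fun _ => false) (fun _ => 1) a ε (η + gnoFolEmb y) :=
    fun y hy => by
    have hyR : R₁ < ‖y - ys‖ := by
      have := hy.2; rwa [mem_closedBall, dist_eq_norm, not_le] at this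
    by_cases hyρ : y ∈ closedBall (0 : GnoFol L) ρ
    · have h := hquad y hyρ
      have hsq : R₁ ^ 2 ≤ ‖y - ys‖ ^ 2 := pow_le_pow_left₀ hR₁pos.le hyR.le 2
      have h2 : μ * R₁ ^ 2 / 4 ≤ μ / 4 * ‖y - ys‖ ^ 2 := by
        calc μ * R₁ ^ 2 / 4 = μ / 4 * R₁ ^ 2 := by ring
          _ ≤ μ / 4 * ‖y - ys‖ ^ 2 := mul_le_mul_of_nonneg_left hsq (by positivity)
      exact le_trans (by linarith) h
    · have h := hgap y hyρ
      have hR₁ρ : R₁ ≤ ρ := by linarith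
      have hsq : R₁ ^ 2 ≤ ρ ^ 2 := pow_le_pow_left₀ hR₁pos.le hR₁ρ 2
      have h2 : μ * R₁ ^ 2 / 4 ≤ 3 * μ * ρ ^ 2 / 4 := by
        calc μ * R₁ ^ 2 / 4 = μ / 4 * R₁ ^ 2 := by ring
          _ ≤ μ / 4 * ρ ^ 2 := mul_le_mul_of_nonneg_left hsq (by positivity)
          _ ≤ 3 * μ * ρ ^ 2 / 4 := by
            have hμρ : 0 ≤ μ * ρ ^ 2 := by positivity
            linarith
      exact le_trans (by linarith) h
  -- the Gaussian ceiling with tail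
  have hδ1 : 1 / (2 * d) < 1 := by rw [div_lt_one (by positivity)]; linarith
  obtain ⟨-, hbd⟩ := setIntegral_exp_neg_mul_le_gaussian_add_tail (hAs (η + gnoFolEmb ys)) (by positivity : 0 < μ / 2) hAys hδ1 hb zero_le_one
    MeasurableSet.univ measurableSet_closedBall hGm hwm ys hfloor hfar (fun y _ => (hw0 y).le) (fun y _ => hw1 y) hwi.integrableOn
  rw [Measure.restrict_univ, one_mul, hddef] at hbd
  exact hbd

end Summit.QuantumFields.YangMills.Theorems.SwapVirialDeficit.BlowUpRing

end
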